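import Summits.NavierStokesRegularity.FluidComputer.ClayBlowupZoomTypeI
import Summits.NavierStokesRegularity.NavierStokesRegularity.Theorems.LiouvilleConjectureNS
import HarnessLib

/-!
# KNSS's LIOUVILLE CONJECTURE (L) EXCLUDES TYPE I CLAY BLOW-UPS — WITH THE CLAY FORCE

Cell `ns-blowup`, seat `ns-blowup-ecbridge-2` (g10; the E–C endpoint theory seat). LABEL: E–C typing
(KERNEL — conditional on the tree's `@[conjecture]` `LiouvilleConjectureNS`, taken as an explicit
hypothesis; no named fact). WHAT THIS IS NOT: not Navier–Stokes evidence — a necessary condition on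
the TYPE `ClayBlowup ν` (no inhabitant is claimed anywhere); (L) is NOT asserted. Companion memo:
`run/shared/lean/pub/ns-blowup/ecbridge2/ECBRIDGE-2-MEMO-9.md`.

Koch–Nadirashvili–Seregin–Šverák 2009, §1: the Liouville conjecture (L) — bounded ancient mild
solutions are constant — «would exclude Type I blow-up». On the (C) type WITH its Clay force this is
now a three-line composition: the zoom with force (`exists_zoom_limit`: the blow-up limit is an
UNFORCED bounded ancient mild solution, `IsKNSSBlowupLimit`), Type I passing to the limit
(`typeI_decay_of_zoom`), and the end-game `false_of_sliceConst_of_typeI_decay` (slice-constant +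
Type-I decay + non-trivial is impossible, KNSS Remark 6.1).

* **`ClayBlowup.not_typeI_forced_of_liouvilleConjecture`** — `LiouvilleConjectureNS →` for every Clay
  blow-up (`ν > 0`, ANY Clay force), `¬ IsTypeIBlowup X.u X.T`; `DesignedBlowup`/`Realisation` twins;
  the (C)-reading `breakdownR3_not_typeI_of_liouvilleConjecture`.

References: Koch–Nadirashvili–Seregin–Šverák, Acta Math. 203 (2009), §1 and §6
[cite: KochNadirashviliSereginSverak2009, §1 and Prop 6.1]; C. L. Fefferman, (C)
[cite: FeffermanClay2006, (C)].
-/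

noncomputable section

namespace Summit.NavierStokesRegularity.FluidComputer

open Set MeasureTheory Filter Topology Function Metric
open scoped ENNReal NNReal
open Literature.Analysis Literature.Analysis.FluidPDE
open Summit.NavierStokesRegularity.NavierStokesRegularity

namespace ClayBlowup

/-- **(L) ⇒ NO TYPE I CLAY BLOW-UP, viscosity `1` core** (no named fact; (L) a hypothesis): the zoom
limit is a bounded ancient mild solution, which (L) makes slice-constant (a.e., hence everywhere by
continuity); under Type I it decays like `C/√(−s)` and is non-trivial near the vertex — impossible
(`false_of_sliceConst_of_typeI_decay`). [cite: KochNadirashviliSereginSverak2009, §1 and Prop 6.1] -/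
theorem not_typeI_forced_one_of_liouvilleConjecture (Y : ClayBlowup 1)
    (hL : Summit.NavierStokesRegularity.NavierStokesRegularity.LiouvilleConjectureNS) :
    ¬ IsTypeIBlowup Y.u Y.T := by
  rintro ⟨C, hC⟩
  obtain ⟨t, x, c, φ, W, δ, hφ, hδ, ht, hc, -, hk1, -, -, hWc, hWdiv, hWmild, -, hW1, -, hknss, -,
    hconv⟩ := Y.exists_zoom_limit
  have hpt : ∀ s < 0, ∀ y, Tendsto
      (fun j => (c (φ j) • stPull (c (φ j) ^ 2) (c (φ j)) (t (φ j)) (x (φ j)) Y.u) s y) atTop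
      (𝓝 (W s y)) := fun s hs y =>
    ((hconv s (hs.trans hδ)).tendstoLocallyUniformlyOn (s := univ)).tendsto_at (mem_univ y)
  have hWc0 : ContinuousOn (uncurry W) (Iio 0 ×ˢ univ) :=
    hWc.mono (prod_mono (fun s hs => lt_trans hs hδ) subset_rfl)
  have hWdiv0 : ∀ s < 0, IsWeaklyDivFree (W s) := fun s hs => hWdiv s (hs.trans hδ)
  have hWmild0 : ∀ s τ : ℝ, s < τ → τ < 0 → ∀ y,
      W τ y = UnboundedOperators.heatExtension (W s) (τ - s) y - oseenDuhamel 1 s W W τ y :=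
    fun s τ hsτ hτ y => hWmild s τ hsτ (hτ.trans hδ) y
  have hWbd0 : ∀ s < 0, ∀ y, ‖W s y‖ ≤ 1 := fun s hs y => hW1 s hs.le y
  have hWsc : ∀ s < 0, Continuous (W s) := fun s hs =>
    hWc.comp_continuous (Continuous.prodMk_right s) fun y => ⟨hs.trans hδ, mem_univ y⟩
  obtain ⟨hsm, -⟩ := smooth_and_bounds_of_bounded_ancient_oseenMild hWc0 hWdiv0 hWmild0 hWbd0
  have hslice : ∀ s < 0, ContDiff ℝ (⊤ : ℕ∞) (W s) := fun s hs =>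
    hsm.comp_contDiff (contDiff_prodMk_right s) fun y => mk_mem_prod (mem_Iio.2 hs) (mem_univ y)
  have hIW : ∀ s < 0, ∀ y, Real.sqrt (-s) * ‖W s y‖ ≤ C := Y.typeI_decay_of_zoom hC ht hc hk1 hφ hpt
  have hnt : ∃ s < 0, ∃ y, W s y ≠ 0 := by
    obtain ⟨s, hs, y, hy⟩ := hknss.exists_lt_norm (1 / 2) (by norm_num)
    exact ⟨s, hs, y, fun h => by rw [h, norm_zero] at hy; linarith⟩
  -- (L): every slice is a.e. constant, hence constant
  have hconst : ∀ s < 0, ∀ y, W s y = W s 0 := by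
    intro s hs y
    obtain ⟨b, hb⟩ := hL W hknss.isBoundedAncientMildSolution hknss.aestronglyMeasurable s hs
    have heq : W s = fun _ => b := ((hWsc s hs).ae_eq_iff_eq volume continuous_const).1 hb
    rw [heq]
  exact false_of_sliceConst_of_typeI_decay (C := C) (fun s hs => (hslice s hs).of_le (by norm_cast))
    ⟨1, hWbd0⟩ hWdiv0 hWmild0 hnt hIW hconst

/-- **KNSS's LIOUVILLE CONJECTURE (L) EXCLUDES TYPE I CLAY BLOW-UPS, WITH THE CLAY FORCE** (`ν > 0`,
ANY Clay force; no named fact; (L) = `LiouvilleConjectureNS` is a hypothesis): exactly as for the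
unforced problem, because the blow-up limit of a forced Clay blow-up is unforced.
[cite: KochNadirashviliSereginSverak2009, §1 («(L) would exclude Type I blow-up»)] -/
theorem not_typeI_forced_of_liouvilleConjecture {ν : ℝ} (X : ClayBlowup ν) (hν : 0 < ν)
    (hL : Summit.NavierStokesRegularity.NavierStokesRegularity.LiouvilleConjectureNS) :
    ¬ IsTypeIBlowup X.u X.T := fun hI =>
  (X.rescale hν one_pos).not_typeI_forced_one_of_liouvilleConjecture hL
    (X.isTypeIBlowup_rescale hν one_pos hI)

end ClayBlowup

/-- **(L) ⇒ no Type I designed blow-up, with its force.** [cite: KochNadirashviliSereginSverak2009, §1] -/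
theorem DesignedBlowup.not_typeI_forced_of_liouvilleConjecture {ν : ℝ} (D : DesignedBlowup ν)
    (hν : 0 < ν) (hL : Summit.NavierStokesRegularity.NavierStokesRegularity.LiouvilleConjectureNS) :
    ¬ IsTypeIBlowup D.u D.T :=
  D.toClayBlowup.not_typeI_forced_of_liouvilleConjecture hν hL

/-- **(L) ⇒ no Type I tower realisation, with its forcing.** [cite: KochNadirashviliSereginSverak2009, §1] -/
theorem PalasekTowerClayBridge.Realisation.not_typeI_of_liouvilleConjecture {ν : ℝ} {R : TowerRates}
    (W : PalasekTowerClayBridge.Realisation ν R) (hν : 0 < ν)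
    (hL : Summit.NavierStokesRegularity.NavierStokesRegularity.LiouvilleConjectureNS) :
    ¬ IsTypeIBlowup W.u W.T :=
  W.toDesignedBlowup.not_typeI_forced_of_liouvilleConjecture hν hL

/-- **(C)-READING**: if Fefferman's (C) holds and KNSS's Liouville conjecture (L) holds, then at every
`ν > 0` there is a Clay blow-up, and it is Type II. [cite: KochNadirashviliSereginSverak2009, §1]
[cite: FeffermanClay2006, (C)] -/
theorem breakdownR3_not_typeI_of_liouvilleConjecture
    (h : Summit.NavierStokesRegularity.NavierStokesRegularity.NavierStokesBreakdownR3)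
    (hL : Summit.NavierStokesRegularity.NavierStokesRegularity.LiouvilleConjectureNS) {ν : ℝ}
    (hν : 0 < ν) : ∃ X : ClayBlowup ν, ¬ IsTypeIBlowup X.u X.T := by
  obtain ⟨X⟩ := forall_nonempty_clayBlowup_of_breakdownR3 h ν hν
  exact ⟨X, X.not_typeI_forced_of_liouvilleConjecture hν hL⟩

end Summit.NavierStokesRegularity.FluidComputer

end
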